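import Summits.BirchSwinnertonDyer.Rank1Residual.Supersingular.BlindPointDerivAt
import Summits.BirchSwinnertonDyer.Rank1Residual.Supersingular.BlindPointFlatTwoElim
import Summits.BirchSwinnertonDyer.Rank1Residual.Supersingular.BlindPointFlatTwoFE
import Literature.NumberTheory.EllipticCurves.Sprung2017.SharpFlatPAdicLFunctionUniqueProofs
import Literature.NumberTheory.EllipticCurves.Sprung2017.SharpFlatPAdicLFunctionTwoProofs
import HarnessLib

/-!
# THE BLIND `♭`-LAW AT `T = −2` (`p = 2`): `(9 − a₂²)·L♭(−2) + a₂·L♯(−2) = 0`, i.e.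
# `5·L♭(−2) + a₂·L♯(−2) = 0` at `a₂ = ±2` and `L♭(−2) = 0` at `a₂ = 0`, for every Sprung pair at a
# good supersingular `2` with `w(E ⊗ χ₈) = +1` (cell `b2b-bsdres`, O1 sub-cell `p = 2`; cc-typer-4
# GEN 7, typer item (27″) "9b as a theorem", part 2/2 = assembly)

HONEST FRAMING (run/shared/lean/b2b/bsd-rank1-residual/, verbatim in every file): the goal of the
cell is to DELETE the COMBINATION-SHAPED residual classes of the Birch–Swinnerton-Dyer formula for
ALL analytic-rank `≤ 1` elliptic curves over `ℚ` — "full BSD formula for every rank `≤ 1` curve in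
class `C`" assembled STRICTLY from published theorems — so that the rank-`≤ 1` remainder becomes
exactly the CONSTRUCTION-SHAPED classes, which are TYPED (missing-input `Prop`s), NOT attempted.
This is not "finishing BSD". THEOREMS ONLY about the tree's typed objects (`IsSprungPair`,
`mazurTateElement`, `IsFrickeEigen`, `BlindLever.evalAt`); every hypothesis explicit; nothing about
any particular curve is asserted; nothing booked; no label moves.

WHAT. lens-1 GEN 9 rider 9b (o1 `ROUTES-O1.md` l.2079; refuter v13 §83: "DERIVATION OF RECORD,
two engines, exact closed forms `D♯/D♭ = a₂/5`") stated: for `E/ℚ` good supersingular at `2` with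
`w(E ⊗ χ₈) = w_E·χ₈(N_E) = +1`, Sprung's pair satisfies `5·L♭_E(−2) + a₂·L♯_E(−2) = 0` (`a₂ = ±2`),
`L♭_E(−2) = 0` (`a₂ = 0`). lens-1 derived it from Sprung's `𝓛og_{α,β}` decomposition
`(L_α, L_β) = (L♯, L♭)·𝓛og` on the open disc and the scalar functional equation of `L_α`, objects
the tree does not have. THIS FILE PROVES IT FROM THE TREE'S FINITE-LEVEL OBJECTS ALONE
(`flatLaw_evalAt_neg_two`): for ANY `f ∈ S₂(Γ₀(N))` with rational coefficients, `2 ∤ N`, `a₂(f) = a`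
even, a Fricke sign `σ` with `σ·χ₈(N) = +1`, and ANY pair `(L♯, L♭) ∈ Λ²` with
`IsSprungPair f 2 a L♯ L♭`:

  **`(9 − a²) · L♭(−2) + a · L♯(−2) = 0`** in `ℤ₂` (`L(−2) := BlindLever.evalAt (−2) L`).

For the newform of an elliptic curve (`flatLaw_evalAt_neg_two_of_isNewformOf`,
`…_of_rootNumber`): good reduction at `2`, `2 ∣ a₂(E)`, `w_E·χ₈(N_E) = +1` ⇒ the same for every
Sprung pair of `E` at `2` (such pairs exist: `exists_isSprungPair_two`).

PROOF (finite level; no `α`, no `𝓛og`, no completed pair). With `Θ_n ∈ ℤ₂[T]` the integral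
Mazur–Tate element (`exists_map_eq_map_mazurTateElement_two`), the congruence of `IsSprungPair`
upgrades to an IDENTITY `Θ_n + u_n L♯ + v_n L♭ = ω_n R_n` in `Λ` (`p`-powers removed by
`IsCongrModOmega.exists_mul_sub_eq`). Apply the ring homomorphism `evalAt (−2)` and the point
derivation `derivAt (−2)` (`BlindPointDerivAt.lean`): since `ω_n(−2) = 0`, `ω_n′(−2) = −2ⁿ`,
`v_n(−2) = 0`, one gets (V) `θ_n(−2) = −c_n L♯(−2)` and (D)
`θ_n′(−2) + d_n L♯(−2) + c_n L♯′(−2) + e_n L♭(−2) ∈ 2ⁿℤ₂` with the blind-point sequences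
`c_n = u_n(−2)`, `d_n = u_n′(−2)`, `e_n = v_n′(−2)` of `BlindPointFlatTwoPrelim.lean`; the
DIFFERENTIATED functional equation (`BlindPointFlatTwoFE.lean`) gives (FE)
`2(2θ_n′(−2) − c·θ_n(−2)) ∈ 2ⁿℤ₂` with `c` the `2`-adic exponent of `⟨N⟩`
(`exists_teichmuller_exponent_natCast`; `κ_n ≡ −c (mod 2ⁿ)`). The abstract two-level elimination
`flat_law_of_levels` (`BlindPointFlatTwoElim.lean`) then yields the law, the constant `a/(9 − a²)`
coming from the telescoping identity `(9 − a²)Σ_{k<n} c_{k+1}c_{k+2} = Q_{n+1} − a`.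

References: F. Sprung, ANT 11 (2017) Thm. 1.12, Cor. 4.4, §1.1 (`p = 2`) [Sprung2017]; B. Mazur,
J. Tate, J. Teitelbaum, Invent. Math. 84 (1986) §I.17 [MazurTateTeitelbaum1986Invent]; K. Ota,
Amer. J. Math. 140 (2018) Prop. 5.16 [Ota2018]; R. Greenberg, LNM 1716 (1999) p. 181
[GreenbergLNM1716]. Folder record: `HOME/class-closure/O1/TYPING.md` §10; the derivation of record
it supersedes as a proof: o1 `ROUTES-O1.md` l.2079 (lens-1 9b), `REFUTER-O1.md` v13 §83.
-/

set_option autoImplicit false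

noncomputable section

open scoped Classical MatrixGroups ModularForm

open Polynomial CongruenceSubgroup Literature.NumberTheory.EllipticCurves
  Literature.NumberTheory.EllipticCurves.ModularForms Literature.NumberTheory.EllipticCurves.Sprung2017

namespace Summit.BirchSwinnertonDyer.Rank1Residual.Supersingular

namespace BlindFlat

open BlindLever

/-! ## §1. The Sprung congruence as an identity in `Λ`, valued and differentiated at `−2` -/

/-- Coercion to power series commutes with mapping the coefficients. [folklore] -/
theorem coe_map_eq_map_coe {R S : Type*} [CommSemiring R] [CommSemiring S] (φ : R →+* S)
    (q : R[X]) : ((q.map φ : S[X]) : PowerSeries S) = PowerSeries.map φ (q : PowerSeries R) := by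
  ext n
  simp [Polynomial.coeff_coe, PowerSeries.coeff_map]

/-- `toIwasawa` is "map the coefficients to `ℤ₂` and coerce". [folklore] -/
theorem toIwasawa_eq_coe (q : ℤ[X]) :
    toIwasawa 2 q = ((q.map (Int.castRingHom ℤ_[2]) : ℤ_[2][X]) : PowerSeries ℤ_[2]) := rfl

/-- An integral lift `Θ` of `θ` solves the congruence `θ ≡ (−1)·(−Θ) (mod ω_n)` exactly. [folklore] -/
theorem isCongrModOmega_neg_coe {n : ℕ} {θ : ℚ[X]} {Θ : ℤ_[2][X]}
    (hΘ : Θ.map (algebraMap ℤ_[2] ℚ_[2]) = θ.map (algebraMap ℚ ℚ_[2])) :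
    IsCongrModOmega 2 n θ (-1) (-(Θ : PowerSeries ℤ_[2])) := by
  refine ⟨0, 0, ?_⟩
  have h1 : iwasawaToPowerSeries 2 (Θ : PowerSeries ℤ_[2]) =
      ((θ.map (algebraMap ℚ ℚ_[2]) : ℚ_[2][X]) : PowerSeries ℚ_[2]) := by
    rw [← hΘ, coe_map_eq_map_coe]
  rw [pow_zero, map_one, one_mul, mul_zero, map_zero, Polynomial.map_neg, Polynomial.map_one,
    Polynomial.coe_neg, Polynomial.coe_one, neg_one_mul, neg_neg, h1, sub_self]

variable {N : ℕ} [NeZero N] {f : CuspForm (Gamma0 N) 2}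

omit [NeZero N] in
/-- **The Sprung congruence as an IDENTITY in `Λ`**: if `θ_n` has the integral lift `Θ`, then
`Θ + u_n L♯ + v_n L♭ = ω_n · R` for some `R ∈ ℤ₂⟦T⟧` (the `p`-powers of "`≡ (mod ω_n)` in `Λ ⊗ ℚ₂`"
are removed by `IsCongrModOmega.exists_mul_sub_eq`). [cite: Sprung2017, Cor. 4.4] -/
theorem exists_coe_add_eq_omega_mul {a : ℤ} {Ls Lf : IwasawaAlgebra 2} (hSP : IsSprungPair f 2 a Ls Lf)
    {n : ℕ} {Θ : ℤ_[2][X]}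
    (hΘ : Θ.map (algebraMap ℤ_[2] ℚ_[2]) = (mazurTateElement f 2 n).map (algebraMap ℚ ℚ_[2])) :
    ∃ R : PowerSeries ℤ_[2], (Θ : PowerSeries ℤ_[2]) + toIwasawa 2 (sharpPoly a 2 n) * Ls +
        toIwasawa 2 (flatPoly a 2 n) * Lf =
      (((cyclotomicOmega 2 n).map (Int.castRingHom ℤ_[2]) : ℤ_[2][X]) : PowerSeries ℤ_[2]) * R := by
  obtain ⟨r, hr⟩ := (hSP n).exists_mul_sub_eq (isCongrModOmega_neg_coe hΘ)
  have hneg : (((-1 : ℤ[X]).map (Int.castRingHom ℤ_[2]) : ℤ_[2][X]) : PowerSeries ℤ_[2]) = -1 := by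
    rw [Polynomial.map_neg, Polynomial.map_one, Polynomial.coe_neg, Polynomial.coe_one]
  rw [hneg] at hr
  exact ⟨-r, by linear_combination -hr⟩

omit [NeZero N] in
/-- `ω_n(−2) = 0` in `ℤ₂` (`n ≥ 1`). [folklore] -/
theorem evalAt_omega_eq_zero {n : ℕ} (hn : 1 ≤ n) :
    evalAt (-2 : ℤ_[2]) (((cyclotomicOmega 2 n).map (Int.castRingHom ℤ_[2]) : ℤ_[2][X]) :
      PowerSeries ℤ_[2]) = 0 := by
  rw [← intCast_neg_two, evalAt_coe_map_intCast, eval_neg_two_cyclotomicOmega hn, Int.cast_zero]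

omit [NeZero N] in
/-- `ω_n′(−2) = −2ⁿ` in `ℤ₂` (`n ≥ 1`). [folklore] -/
theorem derivAt_omega_eq {n : ℕ} (hn : 1 ≤ n) :
    derivAt (-2 : ℤ_[2]) (((cyclotomicOmega 2 n).map (Int.castRingHom ℤ_[2]) : ℤ_[2][X]) :
      PowerSeries ℤ_[2]) = -2 ^ n := by
  rw [← intCast_neg_two, derivAt_coe_map_intCast, eval_neg_two_derivative_cyclotomicOmega hn]
  push_cast
  ring

omit [NeZero N] in
/-- `u_n(−2) = c_n`, `u_n′(−2) = d_n`, `v_n(−2) = 0` (`n ≥ 1`), `v_n′(−2) = e_n` in `ℤ₂`. [folklore] -/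
theorem evalAt_derivAt_sharp_flat (a : ℤ) {n : ℕ} (hn : 1 ≤ n) :
    evalAt (-2 : ℤ_[2]) (toIwasawa 2 (sharpPoly a 2 n)) = ((cSeq a n : ℤ) : ℤ_[2]) ∧
    derivAt (-2 : ℤ_[2]) (toIwasawa 2 (sharpPoly a 2 n)) = ((dSeq a n : ℤ) : ℤ_[2]) ∧
    evalAt (-2 : ℤ_[2]) (toIwasawa 2 (flatPoly a 2 n)) = 0 ∧
    derivAt (-2 : ℤ_[2]) (toIwasawa 2 (flatPoly a 2 n)) = ((eSeq a n : ℤ) : ℤ_[2]) := by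
  refine ⟨?_, ?_, ?_, ?_⟩
  · rw [toIwasawa_eq_coe, ← intCast_neg_two, evalAt_coe_map_intCast]; rfl
  · rw [toIwasawa_eq_coe, ← intCast_neg_two, derivAt_coe_map_intCast]; rfl
  · rw [toIwasawa_eq_coe, ← intCast_neg_two, evalAt_coe_map_intCast, eval_neg_two_flatPoly' a hn,
      Int.cast_zero]
  · rw [toIwasawa_eq_coe, ← intCast_neg_two, derivAt_coe_map_intCast]; rfl

omit [NeZero N] in
/-- **(V) and (D).** For a Sprung pair and an integral lift `Θ` of `θ_n` (`n ≥ 1`):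
`Θ(−2) = −c_n·L♯(−2)` and `Θ′(−2) + d_n L♯(−2) + c_n L♯′(−2) + e_n L♭(−2) = 2ⁿ·ρ` for some
`ρ ∈ ℤ₂`. [cite: Sprung2017, Cor. 4.4] -/
theorem evalAt_and_derivAt_of_isSprungPair {a : ℤ} {Ls Lf : IwasawaAlgebra 2}
    (hSP : IsSprungPair f 2 a Ls Lf) {n : ℕ} (hn : 1 ≤ n) {Θ : ℤ_[2][X]}
    (hΘ : Θ.map (algebraMap ℤ_[2] ℚ_[2]) = (mazurTateElement f 2 n).map (algebraMap ℚ ℚ_[2])) :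
    evalAt (-2 : ℤ_[2]) (Θ : PowerSeries ℤ_[2]) =
        -((cSeq a n : ℤ) : ℤ_[2]) * evalAt (-2 : ℤ_[2]) Ls ∧
      ∃ ρ : ℤ_[2], derivAt (-2 : ℤ_[2]) (Θ : PowerSeries ℤ_[2]) +
          ((dSeq a n : ℤ) : ℤ_[2]) * evalAt (-2 : ℤ_[2]) Ls +
          ((cSeq a n : ℤ) : ℤ_[2]) * derivAt (-2 : ℤ_[2]) Ls +
          ((eSeq a n : ℤ) : ℤ_[2]) * evalAt (-2 : ℤ_[2]) Lf = 2 ^ n * ρ := by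
  have ht := BlindLever.norm_neg_two_lt_one
  obtain ⟨R, hR⟩ := exists_coe_add_eq_omega_mul hSP hΘ
  obtain ⟨hu, hu', hv, hv'⟩ := evalAt_derivAt_sharp_flat a hn
  have hΩ := evalAt_omega_eq_zero hn
  have hΩ' := derivAt_omega_eq hn
  constructor
  · have h := congrArg (evalAt (-2 : ℤ_[2])) hR
    rw [evalAt_add ht, evalAt_add ht, evalAt_mul ht, evalAt_mul ht, evalAt_mul ht, hu, hv, hΩ,
      zero_mul, zero_mul, add_zero] at h
    linear_combination h
  · have h := congrArg (derivAt (-2 : ℤ_[2])) hR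
    rw [derivAt_add ht, derivAt_add ht, derivAt_mul ht, derivAt_mul ht, derivAt_mul ht, hu, hu', hv,
      hv', hΩ, hΩ', zero_mul, zero_add, zero_mul, zero_add] at h
    exact ⟨-evalAt (-2 : ℤ_[2]) R, by linear_combination h⟩

/-! ## §2. Transfers `ℚ → ℚ₂` and `ℤ₂ → ℚ₂` -/

omit [NeZero N] in
/-- The value at `−2` of an integral lift, read in `ℚ₂`, is the rational value of `θ`. [folklore] -/
theorem coe_evalAt_eq_of_map_eq {θ : ℚ[X]} {Θ : ℤ_[2][X]}
    (hΘ : Θ.map (algebraMap ℤ_[2] ℚ_[2]) = θ.map (algebraMap ℚ ℚ_[2])) :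
    ((evalAt (-2 : ℤ_[2]) (Θ : PowerSeries ℤ_[2]) : ℤ_[2]) : ℚ_[2]) = ((θ.eval (-2) : ℚ) : ℚ_[2]) := by
  rw [evalAt_coe]
  have h1 : ((Θ.eval (-2) : ℤ_[2]) : ℚ_[2]) = (Θ.map (algebraMap ℤ_[2] ℚ_[2])).eval (-2) := by
    rw [eval_map, show (-2 : ℚ_[2]) = algebraMap ℤ_[2] ℚ_[2] (-2) by rw [map_neg, map_ofNat],
      eval₂_at_apply]; rfl
  have h2 : ((θ.eval (-2) : ℚ) : ℚ_[2]) = (θ.map (algebraMap ℚ ℚ_[2])).eval (-2) := by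
    rw [eval_map, show (-2 : ℚ_[2]) = algebraMap ℚ ℚ_[2] (-2) by rw [map_neg, map_ofNat],
      eval₂_at_apply, eq_ratCast]
  rw [h1, h2, hΘ]

omit [NeZero N] in
/-- The derivative at `−2` of an integral lift, read in `ℚ₂`, is the rational derivative of `θ`.
[folklore] -/
theorem coe_derivAt_eq_of_map_eq {θ : ℚ[X]} {Θ : ℤ_[2][X]}
    (hΘ : Θ.map (algebraMap ℤ_[2] ℚ_[2]) = θ.map (algebraMap ℚ ℚ_[2])) :
    ((derivAt (-2 : ℤ_[2]) (Θ : PowerSeries ℤ_[2]) : ℤ_[2]) : ℚ_[2]) =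
      (((derivative θ).eval (-2) : ℚ) : ℚ_[2]) := by
  rw [derivAt_coe]
  have hΘ' : (derivative Θ).map (algebraMap ℤ_[2] ℚ_[2]) = (derivative θ).map (algebraMap ℚ ℚ_[2]) := by
    rw [← Polynomial.derivative_map, ← Polynomial.derivative_map, hΘ]
  have h1 : (((derivative Θ).eval (-2) : ℤ_[2]) : ℚ_[2]) =
      ((derivative Θ).map (algebraMap ℤ_[2] ℚ_[2])).eval (-2) := by
    rw [eval_map, show (-2 : ℚ_[2]) = algebraMap ℤ_[2] ℚ_[2] (-2) by rw [map_neg, map_ofNat],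
      eval₂_at_apply]; rfl
  have h2 : (((derivative θ).eval (-2) : ℚ) : ℚ_[2]) =
      ((derivative θ).map (algebraMap ℚ ℚ_[2])).eval (-2) := by
    rw [eval_map, show (-2 : ℚ_[2]) = algebraMap ℚ ℚ_[2] (-2) by rw [map_neg, map_ofNat],
      eval₂_at_apply, eq_ratCast]
  rw [h1, h2, hΘ']

omit [NeZero N] in
/-- The residue `(x mod 2ⁿ).val`, read back in `ℤ₂`, is `x + 2ⁿ·t`. [folklore] -/
theorem exists_val_toZModPow_eq (x : ℤ_[2]) (n : ℕ) :
    ∃ t : ℤ_[2], (((PadicInt.toZModPow n x).val : ℕ) : ℤ_[2]) = x + 2 ^ n * t := by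
  haveI : NeZero (2 ^ n) := ⟨pow_ne_zero _ two_ne_zero⟩
  have hker : (((PadicInt.toZModPow n x).val : ℕ) : ℤ_[2]) - x ∈
      RingHom.ker (PadicInt.toZModPow n : ℤ_[2] →+* ZMod (2 ^ n)) := by
    rw [RingHom.mem_ker, map_sub, map_natCast, ZMod.natCast_zmod_val, sub_self]
  rw [PadicInt.ker_toZModPow, Ideal.mem_span_singleton'] at hker
  obtain ⟨t, ht⟩ := hker
  refine ⟨t, ?_⟩
  have h2 : ((2 : ℕ) : ℤ_[2]) = 2 := by norm_cast
  rw [h2] at ht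
  linear_combination -ht

/-! ## §3. The blind `♭`-law -/

/-- **THE BLIND `♭`-LAW AT `T = −2` (lens-1 9b, as a theorem).** Let `f ∈ S₂(Γ₀(N))` be a
normalised eigenform with rational coefficients (`IsNewform0 f`, `coeffField f = ⊥`), `2 ∤ N`,
`a₂(f) = a` EVEN (good supersingular `2`), with a Fricke sign `σ = ±1` (`f|w_N = −σf`) such that
`σ·χ₈(N) = +1`, and let `(L♯, L♭) ∈ ℤ₂⟦T⟧²` be ANY Sprung pair of `f` at `2`
(`IsSprungPair f 2 a L♯ L♭`). Then, with `L(−2) = BlindLever.evalAt (−2) L ∈ ℤ₂`: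
`(9 − a²)·L♭(−2) + a·L♯(−2) = 0`. [cite: Sprung2017, Thm. 1.12 and Cor. 4.4 (the pair; p = 2 §1.1)]
[cite: MazurTateTeitelbaum1986Invent, §I.17 (functional equation)] -/
theorem flatLaw_evalAt_neg_two (hf0 : IsNewform0 f) (hQ : coeffField f = ⊥) (hN2 : ¬ 2 ∣ N)
    {a : ℤ} (hap : cuspCoeff f 2 = a) (ha : (2 : ℤ) ∣ a) {σ : ℤ} (hσ : σ = 1 ∨ σ = -1)
    (hW : IsFrickeEigen N f (-(σ : ℂ))) (hsign : σ * ZMod.χ₈ (N : ZMod 8) = 1)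
    {Ls Lf : IwasawaAlgebra 2} (hSP : IsSprungPair f 2 a Ls Lf) :
    (9 - ((a : ℤ) : ℤ_[2]) ^ 2) * evalAt (-2 : ℤ_[2]) Lf + ((a : ℤ) : ℤ_[2]) * evalAt (-2 : ℤ_[2]) Ls = 0 := by
  obtain ⟨ηN, c, hc⟩ := exists_teichmuller_exponent_natCast 2 hN2
  choose Θ hΘ using fun n ↦ Sprung2017.exists_map_eq_map_mazurTateElement_two hf0 hQ hN2 hap ha n
  refine flat_law_of_levels (a := a) ha (S := evalAt (-2 : ℤ_[2]) Ls) (S' := derivAt (-2 : ℤ_[2]) Ls)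
    (F := evalAt (-2 : ℤ_[2]) Lf) (c := c)
    (A := fun n ↦ evalAt (-2 : ℤ_[2]) (Θ n : PowerSeries ℤ_[2]))
    (P := fun n ↦ derivAt (-2 : ℤ_[2]) (Θ n : PowerSeries ℤ_[2])) ?_ ?_ ?_
  · intro m
    exact (evalAt_and_derivAt_of_isSprungPair hSP (by omega) (hΘ (m + 1))).1
  · intro m
    exact (evalAt_and_derivAt_of_isSprungPair hSP (by omega) (hΘ (m + 1))).2
  · intro m
    -- (FE) in `ℚ₂`, with `κ = (−s_N).val`, `s_N = c mod 2^{m+1}`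
    obtain ⟨g, hg⟩ := exists_padicInt_fe_neg_two hf0 hQ hN2 hap ha hσ hW hsign
      (show 1 ≤ m + 1 by omega) (hc (m + 1))
    -- `κ ≡ −c (mod 2^{m+1})`
    obtain ⟨t, ht⟩ := exists_val_toZModPow_eq (-c) (m + 1)
    have hκ : (((-PadicInt.toZModPow (m + 1) c).val : ℕ) : ℤ_[2]) = -c + 2 ^ (m + 1) * t := by
      rw [← map_neg]; exact ht
    have hA := coe_evalAt_eq_of_map_eq (hΘ (m + 1))
    have hP := coe_derivAt_eq_of_map_eq (hΘ (m + 1))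
    refine ⟨-g - 2 * t * evalAt (-2 : ℤ_[2]) (Θ (m + 1) : PowerSeries ℤ_[2]), ?_⟩
    have key : ((2 * (2 * derivAt (-2 : ℤ_[2]) (Θ (m + 1) : PowerSeries ℤ_[2]) -
        c * evalAt (-2 : ℤ_[2]) (Θ (m + 1) : PowerSeries ℤ_[2])) : ℤ_[2]) : ℚ_[2]) =
        ((2 ^ (m + 1) * (-g - 2 * t * evalAt (-2 : ℤ_[2]) (Θ (m + 1) : PowerSeries ℤ_[2])) :
          ℤ_[2]) : ℚ_[2]) := by
      have hκ' := congrArg (fun z : ℤ_[2] ↦ (z : ℚ_[2])) hκ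
      have h2c : ((2 : ℤ_[2]) : ℚ_[2]) = 2 := by norm_cast
      push_cast [h2c] at hg hκ' ⊢
      rw [hA, hP]
      linear_combination hg -
        2 * (((mazurTateElement f 2 (m + 1)).eval (-2) : ℚ) : ℚ_[2]) * hκ'
    exact Subtype.ext key

/-- The law in the two supersingular shapes: `a = ±2` ⇒ `5·L♭(−2) + a·L♯(−2) = 0`; `a = 0` ⇒
`L♭(−2) = 0`. [cite: Sprung2017, Thm. 1.12 and Cor. 4.4] -/
theorem flatLaw_evalAt_neg_two_cases (hf0 : IsNewform0 f) (hQ : coeffField f = ⊥) (hN2 : ¬ 2 ∣ N)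
    {a : ℤ} (hap : cuspCoeff f 2 = a) {σ : ℤ} (hσ : σ = 1 ∨ σ = -1)
    (hW : IsFrickeEigen N f (-(σ : ℂ))) (hsign : σ * ZMod.χ₈ (N : ZMod 8) = 1)
    {Ls Lf : IwasawaAlgebra 2} (hSP : IsSprungPair f 2 a Ls Lf) :
    ((a = 2 ∨ a = -2) →
      5 * evalAt (-2 : ℤ_[2]) Lf + ((a : ℤ) : ℤ_[2]) * evalAt (-2 : ℤ_[2]) Ls = 0) ∧
    (a = 0 → evalAt (-2 : ℤ_[2]) Lf = 0) := by
  constructor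
  · intro h2
    have ha : (2 : ℤ) ∣ a := by rcases h2 with rfl | rfl <;> norm_num
    have h := flatLaw_evalAt_neg_two hf0 hQ hN2 hap ha hσ hW hsign hSP
    have hsq : ((a : ℤ) : ℤ_[2]) ^ 2 = 4 := by
      rcases h2 with rfl | rfl <;> push_cast <;> norm_num
    rw [hsq] at h
    linear_combination h
  · rintro rfl
    have h := flatLaw_evalAt_neg_two hf0 hQ hN2 hap (dvd_zero 2) hσ hW hsign hSP
    simp only [Int.cast_zero, zero_mul, add_zero] at h
    have h9 : (9 - (0 : ℤ_[2]) ^ 2) ≠ 0 := by norm_num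
    exact (mul_eq_zero.mp h).resolve_left h9

/-! ## §4. For the newform of an elliptic curve -/

section Curve

variable {W : WeierstrassCurve ℚ} [W.IsElliptic] [W.IsGloballyMinimal]

/-- **The blind `♭`-law for an elliptic curve** `E = W/ℚ` with good SUPERSINGULAR reduction at `2`
(`2 ∣ a₂(E)`), `f ∈ S₂(Γ₀(N))` its newform, `σ = ±1` with `f|w_N = −σ f` and `σ·χ₈(N) = +1`: every
Sprung pair `(L♯, L♭)` of `E` at `2` has `(9 − a₂²)·L♭(−2) + a₂·L♯(−2) = 0`.
[cite: Sprung2017, Thm. 1.12, Cor. 4.4 and §1.1] -/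
theorem flatLaw_evalAt_neg_two_of_isNewformOf (hf : IsNewformOf W f)
    (hgood : W.HasGoodReductionAtPrime 2) (hss : (2 : ℤ) ∣ W.frobeniusTrace 2) {σ : ℤ}
    (hσ : σ = 1 ∨ σ = -1) (hW : IsFrickeEigen N f (-(σ : ℂ)))
    (hsign : σ * ZMod.χ₈ (N : ZMod 8) = 1) {Ls Lf : IwasawaAlgebra 2}
    (hSP : IsSprungPair f 2 (W.frobeniusTrace 2) Ls Lf) :
    (9 - ((W.frobeniusTrace 2 : ℤ) : ℤ_[2]) ^ 2) * evalAt (-2 : ℤ_[2]) Lf +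
      ((W.frobeniusTrace 2 : ℤ) : ℤ_[2]) * evalAt (-2 : ℤ_[2]) Ls = 0 :=
  flatLaw_evalAt_neg_two hf.1 hf.coeffField_eq_bot (not_dvd_level_of_isNewformOf hf hgood)
    (cuspCoeff_eq_frobeniusTrace_of_isNewformOf_holds hf hgood) hss hσ hW hsign hSP

end Curve

section ConductorLevel

variable {W : WeierstrassCurve ℚ} [W.IsElliptic] [W.IsGloballyMinimal] [NeZero (W.conductorNorm ℤ)]
  {f : CuspForm (Gamma0 (W.conductorNorm ℤ)) 2}

/-- **At the conductor level the sign is the root number**: `E = W/ℚ` good supersingular at `2`,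
`f ∈ S₂(Γ₀(N_E))` its newform, `w_E · χ₈(N_E) = +1` (the sign of `E ⊗ χ₈`): every Sprung pair of
`E` at `2` satisfies `(9 − a₂²)·L♭(−2) + a₂·L♯(−2) = 0` — `5L♭(−2) + a₂L♯(−2) = 0` for `a₂ = ±2`,
`L♭(−2) = 0` for `a₂ = 0`. [cite: Sprung2017, Thm. 1.12, Cor. 4.4 and §1.1]
[cite: MazurTateTeitelbaum1986Invent, §I.17] -/
theorem flatLaw_evalAt_neg_two_of_rootNumber (hf : IsNewformOf W f)
    (hgood : W.HasGoodReductionAtPrime 2) (hss : (2 : ℤ) ∣ W.frobeniusTrace 2)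
    (hsign : W.rootNumber * ZMod.χ₈ (W.conductorNorm ℤ : ZMod 8) = 1) {Ls Lf : IwasawaAlgebra 2}
    (hSP : IsSprungPair f 2 (W.frobeniusTrace 2) Ls Lf) :
    (9 - ((W.frobeniusTrace 2 : ℤ) : ℤ_[2]) ^ 2) * evalAt (-2 : ℤ_[2]) Lf +
      ((W.frobeniusTrace 2 : ℤ) : ℤ_[2]) * evalAt (-2 : ℤ_[2]) Ls = 0 := by
  have hw : (W.rootNumber : ℂ) = -frickeEigenvalue f :=
    rootNumber_eq_neg_frickeEigenvalue (fun _ _ ↦ IsNewform0.exists_functional_equation_holds)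
      (fun _ _ ↦ IsNewform0.frickeEigenvalue_eq_one_or_eq_neg_one_holds) hf
  have hsm := IsNewform0.frickeInvolution_eq_smul_holds (N := W.conductorNorm ℤ) (k := (2 : ℤ)) hf.1
  have hFE : IsFrickeEigen (W.conductorNorm ℤ) f (frickeEigenvalue f) :=
    isFrickeEigen_of_frickeInvolution_eq_smul _ hsm
  have hWf : IsFrickeEigen (W.conductorNorm ℤ) f (-((W.rootNumber : ℤ) : ℂ)) := by
    rw [hw, neg_neg]; exact hFE
  exact flatLaw_evalAt_neg_two_of_isNewformOf hf hgood hss W.rootNumber_eq_one_or hWf hsign hSP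

end ConductorLevel

end BlindFlat

end Summit.BirchSwinnertonDyer.Rank1Residual.Supersingular

end
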